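import Summits.CriticalPhenomena.PercolationContinuityZ3.Theses.PercNearOneGluing
import Summits.CriticalPhenomena.PercolationContinuityZ3.Theorems.PercNearOneGluingAdditiveGluingTOfTD
import HarnessLib

/-!
# Crux `PercNearOneGluing.AdditiveGluing` (stmt-CriticalPhenomena-4576), line `tieline`: kernel (T) when the spectator never joins `C_v`

Support file (`--supports stmt-CriticalPhenomena-4576`, stub `stub_kernelT_cNotInL_c14`).  No definitions, no named facts, no sorries.

Relays `u, v`, target `b`, observer `o`, spectator `c`; `D = {u ↮ v}`, `N = {c ↮ u} ∩ {c ↮ v}`, `J = {o ↔ c}`, `μ = prodBernoulli w`.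
The registered kernel (T) = `stub_k0CovTransferQ_c9` is
  `μ(D)·(μ(D∩ub∩vo)·μ(N) − μ(D∩ub∩vc)·μ(N∩J)) ≤ μ(D∩ub)·(μ(D∩vo)·μ(N) − μ(D∩vc)·μ(N∩J))`.
Here: the degenerate sub-case `μ(D ∩ vc) = 0`.  Then `μ(D ∩ ub ∩ vc) = 0` as well, and (T) collapses to
`μ(N)` times the vdBHK negative correlation `μ(D)·μ(D∩ub∩vo) ≤ μ(D∩ub)·μ(D∩vo)` (`TOfTD.negCorr` at `c := o`).
[cite: VandenbergHaggstromKahn2005, Thm. 1.5 (p. 7)]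
-/

namespace Summit.CriticalPhenomena.PercolationContinuityZ3.Cruxes.AdditiveGluing.TieLine

open MeasureTheory Set Literature.Probability.LatticeModels Literature.Probability.Percolation
open Summit.CriticalPhenomena.PercolationContinuityZ3.Theorems

/-- **Kernel (T), sub-case `c ∉ C_v` a.s. on `D`** (line `tieline`, stub `stub_kernelT_cNotInL_c14`): if `μ(D ∩ {v ↔ c}) = 0` then
(T) holds, since both `vc`-terms vanish and what is left is `μ(N) ≥ 0` times the vdBHK negative correlation
`μ(D)·μ(D ∩ ub ∩ vo) ≤ μ(D ∩ ub)·μ(D ∩ vo)`. [cite: VandenbergHaggstromKahn2005, Thm. 1.5 (p. 7)] -/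
theorem stub_kernelT_cNotInL_c14 : ∀ (n : ℕ) (w : Sym2 (Fin n) → unitInterval) (o b u v c : Fin n), (Literature.Probability.LatticeModels.prodBernoulli w).real ((Literature.Probability.Percolation.openConn u v)ᶜ ∩ Literature.Probability.Percolation.openConn v c : Set (Literature.Probability.Percolation.BondConfig (Fin n))) = 0 → (Literature.Probability.LatticeModels.prodBernoulli w).real ((Literature.Probability.Percolation.openConn u v)ᶜ : Set (Literature.Probability.Percolation.BondConfig (Fin n))) * ((Literature.Probability.LatticeModels.prodBernoulli w).real ((Literature.Probability.Percolation.openConn u v)ᶜ ∩ Literature.Probability.Percolation.openConn u b ∩ Literature.Probability.Percolation.openConn v o : Set (Literature.Probability.Percolation.BondConfig (Fin n))) * (Literature.Probability.LatticeModels.prodBernoulli w).real ((Literature.Probability.Percolation.openConn c u)ᶜ ∩ (Literature.Probability.Percolation.openConn c v)ᶜ : Set (Literature.Probability.Percolation.BondConfig (Fin n))) - (Literature.Probability.LatticeModels.prodBernoulli w).real ((Literature.Probability.Percolation.openConn u v)ᶜ ∩ Literature.Probability.Percolation.openConn u b ∩ Literature.Probability.Percolation.openConn v c : Set (Literature.Probability.Percolation.BondConfig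 (Fin n))) * (Literature.Probability.LatticeModels.prodBernoulli w).real ((Literature.Probability.Percolation.openConn c u)ᶜ ∩ (Literature.Probability.Percolation.openConn c v)ᶜ ∩ Literature.Probability.Percolation.openConn o c : Set (Literature.Probability.Percolation.BondConfig (Fin n)))) ≤ (Literature.Probability.LatticeModels.prodBernoulli w).real ((Literature.Probability.Percolation.openConn u v)ᶜ ∩ Literature.Probability.Percolation.openConn u b : Set (Literature.Probability.Percolation.BondConfig (Fin n))) * ((Literature.Probability.LatticeModels.prodBernoulli w).real ((Literature.Probability.Percolation.openConn u v)ᶜ ∩ Literature.Probability.Percolation.openConn v o : Set (Literature.Probability.Percolation.BondConfig (Fin n))) * (Literature.Probability.LatticeModels.prodBernoulli w).real ((Literature.Probability.Percolation.openConn c u)ᶜ ∩ (Literature.Probability.Percolation.openConn c v)ᶜ : Set (Literature.Probability.Percolation.BondConfig (Fin n))) - (Literature.Probability.LatticeModels.prodBernoulli w).real ((Literature.Probability.Percolation.openConn u v)ᶜ ∩ Literature.Probability.Percolation.openConn v c : Set (Literature.Probability.Percolation.BondConfig (Fin n))) * (Literature.Probability.LatticeModels.prodBernoulli w).real ((Literature.Probability.Percolation.openConn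 c u)ᶜ ∩ (Literature.Probability.Percolation.openConn c v)ᶜ ∩ Literature.Probability.Percolation.openConn o c : Set (Literature.Probability.Percolation.BondConfig (Fin n)))) := by
  intro n w o b u v c h0
  by_cases huv : u = v
  · subst huv
    simp only [SpectatorEdgeBHK.compl_openConn_self, empty_inter, measureReal_empty, zero_mul, le_refl]
  -- μ(D ∩ ub ∩ vc) = 0 by monotonicity
  have h1 : (prodBernoulli w).real
      ((openConn u v)ᶜ ∩ openConn u b ∩ openConn v c : Set (BondConfig (Fin n))) = 0 := by
    refine le_antisymm ?_ measureReal_nonneg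
    calc (prodBernoulli w).real ((openConn u v)ᶜ ∩ openConn u b ∩ openConn v c : Set (BondConfig (Fin n)))
        ≤ (prodBernoulli w).real ((openConn u v)ᶜ ∩ openConn v c : Set (BondConfig (Fin n))) :=
          measureReal_mono (fun ω hω => ⟨hω.1.1, hω.2⟩)
      _ = 0 := h0
  -- vdBHK negative correlation for the pair (b, o)
  have hX := TOfTD.negCorr w b u v o huv
  rw [show ((openConn u v)ᶜ ∩ (openConn u b ∩ openConn v o) : Set (BondConfig (Fin n))) =
      (openConn u v)ᶜ ∩ openConn u b ∩ openConn v o from (inter_assoc _ _ _).symm] at hX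
  have hN : 0 ≤ (prodBernoulli w).real ((openConn c u)ᶜ ∩ (openConn c v)ᶜ : Set (BondConfig (Fin n))) :=
    measureReal_nonneg
  rw [h0, h1]
  simp only [zero_mul, sub_zero, ← mul_assoc]
  exact mul_le_mul_of_nonneg_right (by linarith [hX]) hN

end Summit.CriticalPhenomena.PercolationContinuityZ3.Cruxes.AdditiveGluing.TieLine
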